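import Summits.QuantumFields.YangMills.Theorems.PoincareLipschitzHierAlignT3SharpLetters
import HarnessLib

/-!
# Crux stmt-QuantumFields-19936 `HistoryTailL` — S-ALIGN (S2) data: the coarse and fine data of one sharp step at the crux's windows

Cell `ym3-torus` (rung R3 = YM₃ on T³ — a RUNG, NOT the Clay problem), width seat `ym-ust-19936-w3` gen 12, `--supports stmt-QuantumFields-19936 --as helper`.
Summons w2 g11 02:42:44Z «w3 g12: S-ALIGN».  Split off ✓`PoincareLipschitzHierAlignT3Sharp`: `tdist_block_le`, `tdist_cube_le`, ★`coarse_data` (the gauged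
`(i+1)`-fold average is `X`-small on unit cubes near the block set — induction hypothesis on the region `5L^{j+1} + 12(L^{i+1} − 1)` — and
`4θBal(K−(i+1))`-small in its `3`-cube axial gauges, ✓`T4AxialGaugeSmallField`, windows at level `i+1`), `fine_plaq_data` (fine plaquettes within `6`
blocks are inside the level-`i` window).  Def-free.
-/


noncomputable section

open scoped BigOperators

namespace Summit.QuantumFields.YangMills.Theorems.PoincareLipschitzHierAlignT3SharpData

open Literature.MathematicalPhysics.QuantumFieldTheory.Balaban1983to89
open Literature.MathematicalPhysics.QuantumFieldTheory.Balaban1983to89.T3ContinuumYM3Torus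
open Literature.MathematicalPhysics.QuantumFieldTheory.Balaban1983to89.T3UnitLawDensityEML
open T4Continuum BlockAveraging ExpMeanLog T3UnitScaleTilt
open Literature.MathematicalPhysics.QuantumFieldTheory.Balaban1983to89.B3Taylor310LocalRemainder (tdist_triangle tdist_comm tdist_self)
open Summit.QuantumFields.YangMills.Theorems.PoincareLipschitzHierAlignT3Geometry
open Summit.QuantumFields.YangMills.Theorems.PoincareLipschitzHierAlignT3 (twentytwo_lt_sitesPerDir_succ guard_lt_deltaSU)
open Summit.QuantumFields.YangMills.Theorems.PoincareLipschitzHierAlignT3Level (exists_hierGauge_dist1_le_of_windows_level)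
open T4AxialGaugeSmallField (castSite castSite_apply boxPlaqs axialGauge dist1_gaugeAct_axialGauge_le_uniform)
open B7Prop1Explicit (e e_apply)

open Summit.QuantumFields.YangMills.Theorems.PoincareLipschitzHierAlignT3SharpLetters

variable {F : T3Family} {K j : ℕ} {γ b₀ p₀ : ℝ}

/-- A fine site is within `3L^{i+1} − 3L^i` (scaled) of its block. [folklore] -/
theorem tdist_block_le {i : ℕ} (hi1 : i + 1 ≤ (F.P K).m + (F.P K).K) (hL3 : 3 ≤ F.L) (x : Site (F.P K) i) :
    Site.tdist (fun k => ((((x k).val * F.L ^ i : ℕ)) : ZMod ((F.P K).sitesPerDir 0)))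
      (fun k => ((((blockOf x k).val * F.L ^ (i + 1) : ℕ)) : ZMod ((F.P K).sitesPerDir 0))) + 3 * F.L ^ i ≤ 3 * F.L ^ (i + 1) := by
  have h := tdist_scaled_blockOf_le (F := F) (K := K) hi1 x
  have e1 : (F.L - 1) * F.L ^ i + F.L ^ i = F.L ^ (i + 1) := by
    have h' : F.L - 1 + 1 = F.L := by omega
    calc (F.L - 1) * F.L ^ i + F.L ^ i = (F.L - 1 + 1) * F.L ^ i := by ring
      _ = F.L ^ (i + 1) := by rw [h', pow_succ, mul_comm]
  omega

/-- Unit-cube neighbours at level `i+1` are within `3L^{i+1}` (scaled). [folklore] -/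
theorem tdist_cube_le {i : ℕ} (hi1 : i + 1 ≤ (F.P K).m + (F.P K).K) (y s : Site (F.P K) (i + 1))
    (hys : ∀ k, ∃ e : ℤ, -1 ≤ e ∧ e ≤ 1 ∧ y k = s k + ((e : ℤ) : ZMod ((F.P K).sitesPerDir (i + 1)))) :
    Site.tdist (fun k => ((((y k).val * F.L ^ (i + 1) : ℕ)) : ZMod ((F.P K).sitesPerDir 0)))
      (fun k => ((((s k).val * F.L ^ (i + 1) : ℕ)) : ZMod ((F.P K).sitesPerDir 0))) ≤ 3 * F.L ^ (i + 1) := by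
  rw [tdist_scaled_eq (F := F) (K := K) hi1 y s, mul_comm]
  exact Nat.mul_le_mul_right _ (tdist_le_three_of_inCube y s hys)

/-- ★ **THE COARSE DATA OF THE SHARP STEP AT LEVEL `i < j`**: the gauged `(i+1)`-fold average `G = (Ū^{i+1}U)^{h'}` is `X`-small on the unit cubes around
every coarse site within a unit cube of the block set (induction hypothesis on the region `5L^{j+1} + 12(L^{i+1} − 1)`), and its `3`-cube axial
gauges make it `4θBal(K−(i+1))`-small there (windows at level `i+1`, ✓`T4AxialGaugeSmallField`). [folklore] -/
theorem coarse_data (hjK : j + 3 ≤ K) (hγ : 0 < γ) (hγ1 : γ ≤ 1) (hb : 0 < b₀)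
    (a : Plaq (F.P K) (j + 1)) (U : GaugeField (F.P K) 0 (Matrix.specialUnitaryGroup (Fin 2) ℂ))
    (hU : (∀ (i : ℕ) (q : Plaq (F.P K) i), i < j + 1 → Site.tdist (fun k => ((((q.src k).val * F.L ^ i : ℕ)) : ZMod ((F.P K).sitesPerDir 0))) (fun k => ((((a.src k).val * F.L ^ (j + 1) : ℕ)) : ZMod ((F.P K).sitesPerDir 0))) + 64 * F.L ^ i ≤ 64 * F.L ^ (j + 1) → GaugeGroup.dist1 (GaugeField.plaqHol (Averaging.iter (fun i' => BlockAveraging.blockAvg (P := F.P K) (j := i') T3UnitLawDensityEML.ℰp) i U) q) < T3UnitScaleTilt.θBal F.L γ b₀ p₀ (K - i))) {i : ℕ} (hij : i < j)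
    (h' : GaugeTransf (F.P K) (i + 1) (Matrix.specialUnitaryGroup (Fin 2) ℂ)) {X : ℝ}
    (hh' : ∀ c : PBond (F.P K) (i + 1),
      Site.tdist (fun k => ((((c.src k).val * F.L ^ (i + 1) : ℕ)) : ZMod ((F.P K).sitesPerDir 0)))
          (fun k => ((((a.src k).val * F.L ^ (j + 1) : ℕ)) : ZMod ((F.P K).sitesPerDir 0))) ≤ 5 * F.L ^ (j + 1) + 12 * (F.L ^ (i + 1) - 1) →
      dist1 (GaugeField.gaugeAct h' (Averaging.iter (fun i' => BlockAveraging.blockAvg (P := F.P K) (j := i') T3UnitLawDensityEML.ℰp) (i + 1) U) c) ≤ X) :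
    ∀ y : Site (F.P K) (i + 1),
      (∃ s ∈ {s : Site (F.P K) (i + 1) | Site.tdist (fun k => ((((s k).val * F.L ^ (i + 1) : ℕ)) : ZMod ((F.P K).sitesPerDir 0)))
          (fun k => ((((a.src k).val * F.L ^ (j + 1) : ℕ)) : ZMod ((F.P K).sitesPerDir 0))) + 3 * F.L ^ i + 12 ≤
            5 * F.L ^ (j + 1) + 12 * F.L ^ i + 3 * F.L ^ (i + 1)},
        ∀ k, ∃ e : ℤ, -1 ≤ e ∧ e ≤ 1 ∧ y k = s k + ((e : ℤ) : ZMod ((F.P K).sitesPerDir (i + 1)))) →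
      ∀ c' : PBond (F.P K) (i + 1),
        (∀ k, ∃ e : ℤ, -1 ≤ e ∧ e ≤ 1 ∧ c'.src k = y k + ((e : ℤ) : ZMod ((F.P K).sitesPerDir (i + 1)))) →
        (∀ k, ∃ e : ℤ, -1 ≤ e ∧ e ≤ 1 ∧ c'.tgt k = y k + ((e : ℤ) : ZMod ((F.P K).sitesPerDir (i + 1)))) →
          dist1 (GaugeField.gaugeAct h' (avgFun (expMeanLogSU (n := Fin 2))
            (Averaging.iter (fun i' => BlockAveraging.blockAvg (P := F.P K) (j := i') T3UnitLawDensityEML.ℰp) i U)) c') ≤ X ∧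
          dist1 (GaugeField.gaugeAct ((fun y : Site (F.P K) (i + 1) => axialGauge
              (GaugeField.gaugeAct h' (avgFun (expMeanLogSU (n := Fin 2))
                (Averaging.iter (fun i' => BlockAveraging.blockAvg (P := F.P K) (j := i') T3UnitLawDensityEML.ℰp) i U)))
              (fun k => ((y k).val : ℤ) - 1) (fun k => ((y k).val : ℤ) + 1)) y)
            (GaugeField.gaugeAct h' (avgFun (expMeanLogSU (n := Fin 2))
              (Averaging.iter (fun i' => BlockAveraging.blockAvg (P := F.P K) (j := i') T3UnitLawDensityEML.ℰp) i U))) c') ≤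
            4 * θBal F.L γ b₀ p₀ (K - (i + 1)) := by
  have hL3 : 3 ≤ F.L := (by obtain ⟨k, hk⟩ := F.hL.1; have := F.hL.2; omega)
  have hm := F.hm
  have hd : (F.P K).d = 3 := rfl
  have hθ0 : ∀ i, 0 ≤ θBal F.L γ b₀ p₀ (K - i) := fun i =>
    (T3MinimiserStabilityReduction.θBal_pos (by omega) hγ hγ1 hb p₀ (K - i)).le
  have hi1 : i + 1 ≤ (F.P K).m + (F.P K).K := by show i + 1 ≤ F.m + K; omega
  have hp1 : F.L ^ (i + 1) ≤ F.L ^ j := Nat.pow_le_pow_right (by omega) (by omega)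
  have hpj : F.L ^ (j + 1) = F.L ^ j * F.L := pow_succ _ _
  have hpi : F.L ^ (i + 1) = F.L ^ i * F.L := pow_succ _ _
  have h9i : 9 * F.L ^ i ≤ 3 * F.L ^ (i + 1) := by
    rw [hpi]
    calc 9 * F.L ^ i = 3 * (F.L ^ i * 3) := by ring
      _ ≤ 3 * (F.L ^ i * F.L) := Nat.mul_le_mul_left _ (Nat.mul_le_mul_left _ hL3)
  have h3ij : 3 * F.L ^ (i + 1) ≤ F.L ^ (j + 1) := by
    rw [hpj]
    calc 3 * F.L ^ (i + 1) = F.L ^ (i + 1) * 3 := by ring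
      _ ≤ F.L ^ j * F.L := Nat.mul_le_mul hp1 hL3
  have hN3 : 3 < (F.P K).sitesPerDir (i + 1) := by
    have h22 := twentytwo_lt_sitesPerDir_succ (F := F) hjK
    have hmono : (F.P K).sitesPerDir (j + 1) ≤ (F.P K).sitesPerDir (i + 1) := by
      show 2 * F.L ^ (F.m + K - (j + 1)) ≤ 2 * F.L ^ (F.m + K - (i + 1))
      exact Nat.mul_le_mul_left _ (Nat.pow_le_pow_right (by omega) (by omega))
    omega
  set V : GaugeField (F.P K) i (Matrix.specialUnitaryGroup (Fin 2) ℂ) :=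
    Averaging.iter (fun i' => BlockAveraging.blockAvg (P := F.P K) (j := i') T3UnitLawDensityEML.ℰp) i U with hV
  have hVavg : Averaging.iter (fun i' => BlockAveraging.blockAvg (P := F.P K) (j := i') T3UnitLawDensityEML.ℰp) (i + 1) U =
      avgFun (expMeanLogSU (n := Fin 2)) V := rfl
  set G : GaugeField (F.P K) (i + 1) (Matrix.specialUnitaryGroup (Fin 2) ℂ) :=
    GaugeField.gaugeAct h' (avgFun (expMeanLogSU (n := Fin 2)) V) with hG
  intro y hyS c' hcs hct
  obtain ⟨s, hsS, hys⟩ := hyS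
  have hsS' : Site.tdist (fun k => ((((s k).val * F.L ^ (i + 1) : ℕ)) : ZMod ((F.P K).sitesPerDir 0)))
      (fun k => ((((a.src k).val * F.L ^ (j + 1) : ℕ)) : ZMod ((F.P K).sitesPerDir 0))) + 3 * F.L ^ i + 12 ≤
        5 * F.L ^ (j + 1) + 12 * F.L ^ i + 3 * F.L ^ (i + 1) := hsS
  have hys' := tdist_cube_le (F := F) hi1 y s hys
  have hcy := tdist_cube_le (F := F) hi1 c'.src y hcs
  -- the region of the induction hypothesis
  have hreg : Site.tdist (fun k => ((((c'.src k).val * F.L ^ (i + 1) : ℕ)) : ZMod ((F.P K).sitesPerDir 0)))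
      (fun k => ((((a.src k).val * F.L ^ (j + 1) : ℕ)) : ZMod ((F.P K).sitesPerDir 0))) ≤ 5 * F.L ^ (j + 1) + 12 * (F.L ^ (i + 1) - 1) := by
    have g1 := tdist_triangle (fun k => ((((c'.src k).val * F.L ^ (i + 1) : ℕ)) : ZMod ((F.P K).sitesPerDir 0)))
      (fun k => ((((y k).val * F.L ^ (i + 1) : ℕ)) : ZMod ((F.P K).sitesPerDir 0)))
      (fun k => ((((a.src k).val * F.L ^ (j + 1) : ℕ)) : ZMod ((F.P K).sitesPerDir 0)))
    have g2 := tdist_triangle (fun k => ((((y k).val * F.L ^ (i + 1) : ℕ)) : ZMod ((F.P K).sitesPerDir 0)))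
      (fun k => ((((s k).val * F.L ^ (i + 1) : ℕ)) : ZMod ((F.P K).sitesPerDir 0)))
      (fun k => ((((a.src k).val * F.L ^ (j + 1) : ℕ)) : ZMod ((F.P K).sitesPerDir 0)))
    have hLi1 : 1 ≤ F.L ^ (i + 1) := Nat.one_le_pow _ _ (by omega)
    omega
  refine ⟨?_, ?_⟩
  · have h1 := hh' c' hreg
    rw [hVavg] at h1
    exact h1
  · -- the axial gauge on the `3`-cube around `y`
    choose es hes1 hes2 hes using hcs
    choose et het1 het2 het using hct
    let x : Fin (F.P K).d → ℤ := fun k => ((y k).val : ℤ) + es k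
    have hxsrc : c'.src = (castSite x : Site (F.P K) (i + 1)) := by
      funext k
      rw [castSite_apply, hes k]
      show y k + ((es k : ℤ) : ZMod ((F.P K).sitesPerDir (i + 1))) =
        ((((((y k).val : ℕ) : ℤ) + es k : ℤ)) : ZMod ((F.P K).sitesPerDir (i + 1)))
      rw [Int.cast_add, Int.cast_natCast, ZMod.natCast_zmod_val]
    have hesμ : es c'.dir ≤ 0 := by
      have h1 : c'.tgt c'.dir = c'.src c'.dir + 1 := by
        show (Site.shift c'.src c'.dir) c'.dir = _
        rw [Site.shift, Function.update_self]
      rw [het, hes, add_assoc] at h1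
      have h4 := add_left_cancel h1
      have h2 : ((et c'.dir : ℤ) : ZMod ((F.P K).sitesPerDir (i + 1))) = (((es c'.dir + 1 : ℤ)) : ZMod ((F.P K).sitesPerDir (i + 1))) := by
        rw [Int.cast_add, Int.cast_one]; exact h4
      have h5 := int_eq_of_cast_eq hN3 ⟨het1 _, (het2 c'.dir).trans (by norm_num)⟩
        ⟨by linarith only [hes1 c'.dir], by linarith only [hes2 c'.dir]⟩ h2
      linarith only [h5, het2 c'.dir]
    have hxlo : (fun k => ((y k).val : ℤ) - 1) ≤ x := fun k => by
      show ((y k).val : ℤ) - 1 ≤ ((y k).val : ℤ) + es k; linarith only [hes1 k]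
    have hxhi : x + e c'.dir ≤ (fun k => ((y k).val : ℤ) + 1) := fun k => by
      show ((y k).val : ℤ) + es k + e c'.dir k ≤ ((y k).val : ℤ) + 1
      rw [e_apply]; split_ifs with hk
      · subst hk; linarith only [hesμ]
      · linarith only [hes2 k]
    have hn : ∀ k, (fun k => ((y k).val : ℤ) + 1) k ≤ (fun k => ((y k).val : ℤ) - 1) k + (2 : ℕ) := fun k => by
      show ((y k).val : ℤ) + 1 ≤ ((y k).val : ℤ) - 1 + ((2 : ℕ) : ℤ); push_cast; linarith only []
    have hnN : 2 < (F.P K).sitesPerDir (i + 1) := by omega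
    -- the coarse plaquettes on the cube are inside the level-`(i+1)` window
    have hwin : PlaqSmallOn (boxPlaqs (fun k => ((y k).val : ℤ) - 1) (fun k => ((y k).val : ℤ) + 1)) (θBal F.L γ b₀ p₀ (K - (i + 1))) G := by
      intro p hp'
      obtain ⟨z, hzlo, hzhi, hsrc⟩ := hp'
      rw [hG]
      refine dist1_plaqHol_gaugeAct_lt h' _ p ?_
      rw [← hVavg]
      refine hU (i + 1) p (by omega) ?_
      have hpy : Site.tdist p.src y ≤ 3 := by
        refine tdist_le_three_of_near p.src y fun k => ?_
        have h1 := hzlo k; have h2 := hzhi k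
        simp only [Pi.add_apply, e_apply] at h2
        have hz3 : ((y k).val : ℤ) - 1 ≤ z k ∧ z k ≤ ((y k).val : ℤ) + 1 := by
          constructor
          · exact h1
          · split_ifs at h2 <;> linarith only [h2]
        have hy : y k = ((((y k).val : ℤ)) : ZMod ((F.P K).sitesPerDir (i + 1))) := by
          rw [Int.cast_natCast, ZMod.natCast_zmod_val]
        rw [hsrc, castSite_apply, hy]
        rcases (show z k = (y k).val ∨ z k = (y k).val + 1 ∨ z k = (y k).val - 1 by omega) with h | h | h
        · left; rw [h]
        · right; left; rw [h]; push_cast; ring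
        · right; right; rw [h]; push_cast; ring
      have hpy' : Site.tdist (fun k => ((((p.src k).val * F.L ^ (i + 1) : ℕ)) : ZMod ((F.P K).sitesPerDir 0)))
          (fun k => ((((y k).val * F.L ^ (i + 1) : ℕ)) : ZMod ((F.P K).sitesPerDir 0))) ≤ 3 * F.L ^ (i + 1) := by
        rw [tdist_scaled_eq (F := F) (K := K) hi1 p.src y, mul_comm]; exact Nat.mul_le_mul_right _ hpy
      have g1 := tdist_triangle (fun k => ((((p.src k).val * F.L ^ (i + 1) : ℕ)) : ZMod ((F.P K).sitesPerDir 0)))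
        (fun k => ((((y k).val * F.L ^ (i + 1) : ℕ)) : ZMod ((F.P K).sitesPerDir 0)))
        (fun k => ((((a.src k).val * F.L ^ (j + 1) : ℕ)) : ZMod ((F.P K).sitesPerDir 0)))
      have g2 := tdist_triangle (fun k => ((((y k).val * F.L ^ (i + 1) : ℕ)) : ZMod ((F.P K).sitesPerDir 0)))
        (fun k => ((((s k).val * F.L ^ (i + 1) : ℕ)) : ZMod ((F.P K).sitesPerDir 0)))
        (fun k => ((((a.src k).val * F.L ^ (j + 1) : ℕ)) : ZMod ((F.P K).sitesPerDir 0)))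
      omega
    have key := dist1_gaugeAct_axialGauge_le_uniform G (subset_refl _) hwin (hθ0 (i + 1)) hn hnN hxlo hxhi
    have ec : (⟨castSite x, c'.dir⟩ : PBond (F.P K) (i + 1)) = c' := by rw [← hxsrc]
    rw [ec] at key
    have hbd : ((((F.P K).d - 1 : ℕ)) : ℝ) = 2 := by rw [hd]; norm_num
    rw [hbd] at key
    show dist1 (GaugeField.gaugeAct (axialGauge G (fun k => ((y k).val : ℤ) - 1) (fun k => ((y k).val : ℤ) + 1)) G c') ≤ _
    push_cast at key
    linarith

/-- **THE FINE DATA OF THE SHARP STEP**: the fine plaquettes within `6` blocks of the block set are inside the level-`i` window. [folklore] -/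
theorem fine_plaq_data (hjK : j + 3 ≤ K) (a : Plaq (F.P K) (j + 1)) (U : GaugeField (F.P K) 0 (Matrix.specialUnitaryGroup (Fin 2) ℂ))
    (hU : (∀ (i : ℕ) (q : Plaq (F.P K) i), i < j + 1 → Site.tdist (fun k => ((((q.src k).val * F.L ^ i : ℕ)) : ZMod ((F.P K).sitesPerDir 0))) (fun k => ((((a.src k).val * F.L ^ (j + 1) : ℕ)) : ZMod ((F.P K).sitesPerDir 0))) + 64 * F.L ^ i ≤ 64 * F.L ^ (j + 1) → GaugeGroup.dist1 (GaugeField.plaqHol (Averaging.iter (fun i' => BlockAveraging.blockAvg (P := F.P K) (j := i') T3UnitLawDensityEML.ℰp) i U) q) < T3UnitScaleTilt.θBal F.L γ b₀ p₀ (K - i))) {i : ℕ} (hij : i < j) :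
    ∀ b : PBond (F.P K) i,
      blockOf b.src ∈ {s : Site (F.P K) (i + 1) | Site.tdist (fun k => ((((s k).val * F.L ^ (i + 1) : ℕ)) : ZMod ((F.P K).sitesPerDir 0)))
          (fun k => ((((a.src k).val * F.L ^ (j + 1) : ℕ)) : ZMod ((F.P K).sitesPerDir 0))) + 3 * F.L ^ i + 12 ≤
            5 * F.L ^ (j + 1) + 12 * F.L ^ i + 3 * F.L ^ (i + 1)} →
      ∀ q : Plaq (F.P K) i, Site.tdist (blockOf q.src) (blockOf b.src) ≤ 2 * (F.P K).d →
        dist1 (GaugeField.plaqHol (Averaging.iter (fun i' => BlockAveraging.blockAvg (P := F.P K) (j := i') T3UnitLawDensityEML.ℰp) i U) q) <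
          θBal F.L γ b₀ p₀ (K - i) := by
  have hL3 : 3 ≤ F.L := (by obtain ⟨k, hk⟩ := F.hL.1; have := F.hL.2; omega)
  have hm := F.hm
  have hd : (F.P K).d = 3 := rfl
  have hi1 : i + 1 ≤ (F.P K).m + (F.P K).K := by show i + 1 ≤ F.m + K; omega
  have hp1 : F.L ^ (i + 1) ≤ F.L ^ j := Nat.pow_le_pow_right (by omega) (by omega)
  have hpj : F.L ^ (j + 1) = F.L ^ j * F.L := pow_succ _ _
  have hpi : F.L ^ (i + 1) = F.L ^ i * F.L := pow_succ _ _
  have h3ij : 3 * F.L ^ (i + 1) ≤ F.L ^ (j + 1) := by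
    rw [hpj]
    calc 3 * F.L ^ (i + 1) = F.L ^ (i + 1) * 3 := by ring
      _ ≤ F.L ^ j * F.L := Nat.mul_le_mul hp1 hL3
  have hii1 : F.L ^ i ≤ F.L ^ (i + 1) := by
    rw [hpi]
    calc F.L ^ i = F.L ^ i * 1 := by ring
      _ ≤ F.L ^ i * F.L := Nat.mul_le_mul_left _ (by omega)
  intro b hbS q hq
  rw [hd] at hq
  refine hU i q (by omega) ?_
  have hbS' : Site.tdist (fun k => ((((blockOf b.src k).val * F.L ^ (i + 1) : ℕ)) : ZMod ((F.P K).sitesPerDir 0)))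
      (fun k => ((((a.src k).val * F.L ^ (j + 1) : ℕ)) : ZMod ((F.P K).sitesPerDir 0))) + 3 * F.L ^ i + 12 ≤
        5 * F.L ^ (j + 1) + 12 * F.L ^ i + 3 * F.L ^ (i + 1) := hbS
  have g1 := tdist_block_le (F := F) hi1 hL3 q.src
  have g2 : Site.tdist (fun k => ((((blockOf q.src k).val * F.L ^ (i + 1) : ℕ)) : ZMod ((F.P K).sitesPerDir 0)))
      (fun k => ((((blockOf b.src k).val * F.L ^ (i + 1) : ℕ)) : ZMod ((F.P K).sitesPerDir 0))) ≤ 6 * F.L ^ (i + 1) := by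
    rw [tdist_scaled_eq (F := F) (K := K) hi1 (blockOf q.src) (blockOf b.src), mul_comm]
    exact Nat.mul_le_mul_right _ hq
  have g4 := tdist_triangle (fun k => ((((q.src k).val * F.L ^ i : ℕ)) : ZMod ((F.P K).sitesPerDir 0)))
    (fun k => ((((blockOf q.src k).val * F.L ^ (i + 1) : ℕ)) : ZMod ((F.P K).sitesPerDir 0)))
    (fun k => ((((a.src k).val * F.L ^ (j + 1) : ℕ)) : ZMod ((F.P K).sitesPerDir 0)))
  have g5 := tdist_triangle (fun k => ((((blockOf q.src k).val * F.L ^ (i + 1) : ℕ)) : ZMod ((F.P K).sitesPerDir 0)))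
    (fun k => ((((blockOf b.src k).val * F.L ^ (i + 1) : ℕ)) : ZMod ((F.P K).sitesPerDir 0)))
    (fun k => ((((a.src k).val * F.L ^ (j + 1) : ℕ)) : ZMod ((F.P K).sitesPerDir 0)))
  omega

end Summit.QuantumFields.YangMills.Theorems.PoincareLipschitzHierAlignT3SharpData

end
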